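import Literature.NumberTheory.GaloisRepresentations.GaloisCohomologyKummerProofs
import Literature.NumberTheory.GaloisRepresentations.LocalWeilDatum
import Mathlib.Topology.Instances.AddCircle.Defs
import HarnessLib

/-!
# Kummer descent of a splitting: a `μ_p`-valued `2`-cocycle which splits in `K̄ˣ` splits in `μ_p`
# (Serre, *Cohomologie galoisienne* II §1.2; *Corps locaux* X §1 — Hilbert 90)

Topic `NumberTheory/GaloisRepresentations`; namespace `Literature.NumberTheory.GaloisRepresentations`.
Theorems only (no definition, no named fact; D-0026).

Let `L` be a field containing the `p`-th roots of unity (`Γ_L` fixes a primitive `ζ ∈ L̄`), and read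
`ℤ/p ≅ μ_p` through an exponential `m : ℚ/ℤ[p] → μ_p`, `m(x+y) = m(x) m(y)`.  If a `p`-torsion
`2`-cocycle `Z : Γ_L × Γ_L → ℚ/ℤ` becomes, as the `L̄ˣ`-valued cocycle `m ∘ Z`, the coboundary of a
locally constant cochain `b : Γ_L → L̄ˣ`, then `Z` itself is the coboundary of a locally constant
`p`-torsion cochain `B : Γ_L → ℚ/ℤ` (`exists_nsmul_split_of_apply_eq_cob`).  Proof (Serre, Durham
§6.5 (a): "`H²(G_K, ℤ/p) = H²(G_K, μ_p) = Br_p(K)`"; the exactness of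
`H¹(Γ_L, L̄ˣ) = 0 → H²(Γ_L, μ_p) → H²(Γ_L, L̄ˣ)`): `b^p` is a `1`-cocycle, hence `σ(a)/a` by Hilbert 90
(`absoluteGaloisGroup.exists_eq_smul_div_of_isLocallyConstant_cocycle`); with `α^p = a` the cochain
`b · α/σ(α)` is `μ_p`-valued and still splits `m ∘ Z`.  This is the argument of the tree's
`hasseInput_of_brauerHassePrinciple` (`TateLevelOneHasseBridge.lean`), isolated for reuse over an
arbitrary field (there: over `ℚ(μ_p)`; here: over the layers of a cyclotomic tower).

## References

* J.-P. Serre, *Cohomologie galoisienne* / *Galois Cohomology* (1997), II §1.2 (Kummer theory,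
  Hilbert 90). [SerreGaloisCohomology1997]
* J.-P. Serre, *Modular forms of weight one and Galois representations* (Durham 1977), §6.5 (a).
  [SerreDurham1977]
-/

noncomputable section

open Field

universe u

namespace Literature.NumberTheory.GaloisRepresentations

open LocalWeilDatum

section Orbit

variable (F : Type*) [Field F]

/-- The orbit map `σ ↦ σ • x` of an element of `F̄` is locally constant on `Γ_F` (its fibres are
cosets of the open stabiliser, `isOpen_stabilizer`). [folklore] -/
private theorem isLocallyConstant_smul_algebraicClosure (x : AlgebraicClosure F) :
    IsLocallyConstant fun σ : absoluteGaloisGroup F => σ • x := by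
  refine (IsLocallyConstant.iff_exists_open _).2 fun σ => ?_
  refine ⟨(fun τ => σ⁻¹ * τ) ⁻¹' (MulAction.stabilizer (absoluteGaloisGroup F) x : Set (absoluteGaloisGroup F)),
    (isOpen_stabilizer F x).preimage (continuous_const.mul continuous_id), ?_, fun τ hτ => ?_⟩
  · simp only [Set.mem_preimage, SetLike.mem_coe, MulAction.mem_stabilizer_iff, inv_mul_cancel, one_smul]
  · simp only [Set.mem_preimage, SetLike.mem_coe, MulAction.mem_stabilizer_iff, mul_smul, inv_smul_eq_iff] at hτ
    exact hτ

end Orbit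

section Kummer

variable (L : Type u) [Field L] {p : ℕ} [hp : Fact p.Prime]

/-- **Kummer descent of a splitting** (Serre II §1.2; Durham §6.5 (a)).  Let `ζ ∈ L̄` be a primitive
`p`-th root of unity fixed by `Γ_L`, `m : ℚ/ℤ → L̄` an exponential onto the powers of `ζ`
(multiplicative and injective on `p`-torsion elements, `(m x)^p = 1`), `Z : Γ_L × Γ_L → ℚ/ℤ` with
`p • Z = 0`, and `b : Γ_L → L̄ˣ` locally constant with `m(Z(σ,τ)) = b(σ) · σ b(τ) / b(στ)`.  Then
`Z(σ,τ) + B(στ) = B(σ) + B(τ)` for a locally constant `B : Γ_L → ℚ/ℤ` with `p • B = 0`: by Hilbert 90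
`b^p = σ(a)/a`, and `B = log_m (b · α/σ(α))` with `α^p = a`.
[cite: SerreGaloisCohomology1997, II §1.2] [cite: SerreDurham1977, §6.5 (a)] -/
theorem exists_nsmul_split_of_apply_eq_cob {ζ : AlgebraicClosure L} (hζ : IsPrimitiveRoot ζ p)
    (hζfix : ∀ σ : absoluteGaloisGroup L, σ • ζ = ζ)
    (m' : AddCircle (1 : ℚ) → AlgebraicClosure L)
    (hm'_add : ∀ x y, p • x = 0 → p • y = 0 → m' (x + y) = m' x * m' y)
    (hm'_inj : ∀ x y, p • x = 0 → p • y = 0 → m' x = m' y → x = y)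
    (hm'_pow : ∀ x, m' x ^ p = 1) (hm'_range : ∀ t, ∃ k : ℕ, m' t = ζ ^ k)
    (hm'_surj : ∀ k : ℕ, ∃ x, p • x = 0 ∧ m' x = ζ ^ k)
    (Z : absoluteGaloisGroup L → absoluteGaloisGroup L → AddCircle (1 : ℚ)) (hZ_p : ∀ σ τ, p • Z σ τ = 0)
    (b' : absoluteGaloisGroup L → (AlgebraicClosure L)ˣ) (hb'_lc : IsLocallyConstant b')
    (hb' : ∀ σ τ, m' (Z σ τ) = (b' σ : AlgebraicClosure L) * σ • (b' τ : AlgebraicClosure L) /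
      (b' (σ * τ) : AlgebraicClosure L)) :
    ∃ B : absoluteGaloisGroup L → AddCircle (1 : ℚ), IsLocallyConstant B ∧ (∀ σ, p • B σ = 0) ∧
      ∀ σ τ, Z σ τ + B (σ * τ) = B σ + B τ := by
  classical
  have hpp : p.Prime := hp.out
  have hζ0 : ζ ≠ 0 := hζ.ne_zero hpp.ne_zero
  have hm'0 : ∀ t, m' t ≠ 0 := fun t => by
    obtain ⟨k, hk⟩ := hm'_range t
    rw [hk]
    exact pow_ne_zero _ hζ0
  have hm'_sub : ∀ x y, p • x = 0 → p • y = 0 → m' (x - y) * m' y = m' x := fun x y hx hy => by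
    rw [← hm'_add _ _ (by rw [nsmul_sub, hx, hy, sub_zero]) hy, sub_add_cancel]
  have hm'_fix : ∀ (ρ : absoluteGaloisGroup L) x, ρ • m' x = m' x := fun ρ x => by
    obtain ⟨k, hk⟩ := hm'_range x
    rw [hk, smul_pow', hζfix]
  -- the `L̄`-valued cochain
  obtain ⟨bv, hbv_def⟩ : ∃ bv : absoluteGaloisGroup L → AlgebraicClosure L,
      bv = fun σ => (b' σ : AlgebraicClosure L) := ⟨_, rfl⟩
  have hbv_apply : ∀ σ, bv σ = (b' σ : AlgebraicClosure L) := fun σ => by rw [hbv_def]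
  have hbv0 : ∀ σ, bv σ ≠ 0 := fun σ => by rw [hbv_apply]; exact (b' σ).ne_zero
  have hbv_lc : IsLocallyConstant bv := by rw [hbv_def]; exact hb'_lc.comp _
  have hbE : ∀ σ τ', bv (σ * τ') * m' (Z σ τ') = bv σ * σ • bv τ' := fun σ τ' => by
    rw [hbv_apply, hbv_apply, hbv_apply, hb', mul_div_cancel₀ _ (b' _).ne_zero]
  -- `bv^p` is a `1`-cocycle: Hilbert 90
  have hcoc1 : ∀ σ τ', (fun σ => bv σ ^ p) (σ * τ') = (fun σ => bv σ ^ p) σ * σ • (fun σ => bv σ ^ p) τ' :=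
    fun σ τ' => by
      have h := congrArg (fun x => x ^ p) (hbE σ τ')
      simp only [mul_pow] at h
      rw [hm'_pow, mul_one] at h
      show bv (σ * τ') ^ p = bv σ ^ p * σ • (bv τ' ^ p)
      rw [h, smul_pow']
  obtain ⟨a, ha0, ha⟩ := absoluteGaloisGroup.exists_eq_smul_div_of_isLocallyConstant_cocycle
    L (hbv_lc.comp fun x => x ^ p) (fun σ => pow_ne_zero _ (hbv0 σ)) hcoc1
  obtain ⟨α, hα⟩ := IsAlgClosed.exists_pow_nat_eq a hpp.pos
  have hα0 : α ≠ 0 := fun h => ha0 (by rw [← hα, h, zero_pow hpp.ne_zero])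
  have hσα0 : ∀ σ : absoluteGaloisGroup L, σ • α ≠ 0 := fun σ => by
    rw [absoluteGaloisGroup.smul_def]
    exact (map_ne_zero _).mpr hα0
  have hσa0 : ∀ σ : absoluteGaloisGroup L, σ • a ≠ 0 := fun σ => by
    rw [absoluteGaloisGroup.smul_def]
    exact (map_ne_zero _).mpr ha0
  -- the corrected cochain `b'' = bv · α / σ(α)` is `μ_p`-valued
  obtain ⟨b'', hb''_def⟩ : ∃ b'' : absoluteGaloisGroup L → AlgebraicClosure L,
      b'' = fun σ => bv σ * α / σ • α := ⟨_, rfl⟩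
  have hb''_apply : ∀ σ, b'' σ = bv σ * α / σ • α := fun σ => by rw [hb''_def]
  have hb''_pow : ∀ σ, b'' σ ^ p = 1 := fun σ => by
    have h : bv σ ^ p = σ • a / a := ha σ
    have h1 := hσa0 σ
    rw [hb''_apply, div_pow, mul_pow, h, ← smul_pow', hα]
    field_simp
  have hb''_lc : IsLocallyConstant b'' := by
    rw [hb''_def]
    exact (hbv_lc.comp fun x => x * α).comp₂ (isLocallyConstant_smul_algebraicClosure L α) fun x y => x / y
  -- exponents: `b''` is `m'` of a `p`-torsion cochain `B`
  have hF : ∀ y : AlgebraicClosure L, ∃ x : AddCircle (1 : ℚ), p • x = 0 ∧ (y ^ p = 1 → m' x = y) := fun y => by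
    by_cases hy : y ^ p = 1
    · obtain ⟨k, -, hk⟩ := hζ.eq_pow_of_pow_eq_one hy
      obtain ⟨x, hxp, hx⟩ := hm'_surj k
      exact ⟨x, hxp, fun _ => by rw [hx, hk]⟩
    · exact ⟨0, smul_zero _, fun h => absurd h hy⟩
  choose F hFp hF using hF
  obtain ⟨B, hB_def⟩ : ∃ B : absoluteGaloisGroup L → AddCircle (1 : ℚ), B = fun σ => F (b'' σ) := ⟨_, rfl⟩
  have hB_apply : ∀ σ, B σ = F (b'' σ) := fun σ => by rw [hB_def]
  have hBp : ∀ σ, p • B σ = 0 := fun σ => by rw [hB_apply]; exact hFp _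
  have hBm : ∀ σ, m' (B σ) = b'' σ := fun σ => by rw [hB_apply]; exact hF _ (hb''_pow σ)
  have hB_lc : IsLocallyConstant B := by rw [hB_def]; exact hb''_lc.comp F
  have hb''_fix : ∀ ρ σ, ρ • b'' σ = b'' σ := fun ρ σ => by rw [← hBm, hm'_fix]
  -- `∂b'' = m' ∘ Z`
  have hEb'' : ∀ σ τ', m' (Z σ τ') * b'' (σ * τ') = b'' σ * b'' τ' := fun σ τ' => by
    have h1 : b'' τ' = σ • b'' τ' := (hb''_fix σ τ').symm
    have h2 := hσα0 σ
    have h3 := hσα0 τ'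
    have h4 := hσα0 (σ * τ')
    have h5 := hbv0 σ
    have h6 := hbv0 τ'
    have h7 := hbv0 (σ * τ')
    have hσb0 : σ • bv τ' ≠ 0 := by
      rw [absoluteGaloisGroup.smul_def]
      exact (map_ne_zero _).mpr (hbv0 τ')
    have hEσ : m' (Z σ τ') = bv σ * σ • bv τ' / bv (σ * τ') := by
      rw [eq_div_iff h7, mul_comm, hbE]
    rw [h1, hEσ]
    simp only [hb''_apply]
    rw [absoluteGaloisGroup.smul_def σ (bv τ' * α / τ' • α), map_div₀, map_mul,
      ← absoluteGaloisGroup.smul_def, ← absoluteGaloisGroup.smul_def,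
      ← absoluteGaloisGroup.smul_def, ← mul_smul]
    field_simp
  refine ⟨B, hB_lc, hBp, fun σ τ' => ?_⟩
  have key : m' (Z σ τ') = m' (B σ + B τ' - B (σ * τ')) := by
    have h := hEb'' σ τ'
    rw [← hBm, ← hBm, ← hBm, ← hm'_add _ _ (hBp σ) (hBp τ'),
      ← hm'_sub (B σ + B τ') (B (σ * τ')) (by rw [nsmul_add, hBp, hBp, add_zero]) (hBp _)] at h
    exact mul_right_cancel₀ (hm'0 _) h
  have h := hm'_inj _ _ (hZ_p _ _) (by rw [nsmul_sub, nsmul_add, hBp, hBp, hBp, add_zero, sub_zero]) key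
  rw [h]
  abel

end Kummer

end Literature.NumberTheory.GaloisRepresentations

end
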